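import Literature.NumberTheory.EllipticCurves.PAdicLFunctionProofs
import Literature.NumberTheory.EllipticCurves.Kato2004.EulerSystemValues
import HarnessLib

/-!
# Route `ThetaPartnerAtTwo` (TP2), crux K3 `SignedKatoDivisibilityUpToAtTwo` (stmt-BirchSwinnertonDyer-20308 / K3P′ 25631), line
# `colemanrat` v13 — the EQUAL-MODULUS TRANSPORT KIT: Dirichlet characters, twisted symbol sums, Gauss sums and unit sums along a
# PROPOSITIONAL equality of moduli `m₁ = m₂` (e.g. `cycLevel p k ∅ = p^k`, `2^(n+2) = 2^(n + cyclotomicExponent 2)`)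

Width seat `bsd-wall-tp2-p2x-w4` g0 (cell `bsd-wall`); item (D4) of the 12:2xZ offer. HONEST FRAMING: theorems only (no definition, no named
fact, no instance, no `sorry`); pure bookkeeping (every proof is `subst` + `changeLevel_self`); closes no item; K3 / K3P′ are NOT settled and
BSD is NOT proved by any of this.

## Why

Kato's value law (`ZetaBody`, (C4)/(C5)) and everything derived from it (bricks B2/B3/B4c, `KatoValue.*`) live at the modulus
`cycLevel p k ∅ = p^k · ∏_{q∈∅} ℓ_q`, because the values `x k r : CyclotomicField (cycLevel p k r.1) ℚ` carry it in their TYPE; the socket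
CORE_χ^prim and the (R3)/B5a files live at `2^(n+2)` (`= 2^(n + cyclotomicExponent 2)`). The equality `cycLevel p k ∅ = p^k` is propositional
(`rw [cycLevel, Finset.prod_empty, mul_one]`), not definitional, so the assembly must move Dirichlet characters and the sums built from them
across it exactly once. The vehicle is Mathlib's `DirichletCharacter.changeLevel (dvd_of_eq h)`; after `subst h` it is `changeLevel (dvd_refl _) = id`
(`changeLevel_self`). Each lemma below is stated with VARIABLE moduli `m₁ m₂` and `h : m₁ = m₂`, so that a consumer can instantiate
`m₁ := 2^(n+2)`, `m₂ := cycLevel 2 (n+2) ∅` (where `subst` is not available).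

## What (`h : m₁ = m₂`, `χ : DirichletCharacter R m₁`, `χ' := changeLevel (dvd_of_eq h) χ : DirichletCharacter R m₂`)

`cycLevel_empty_eq` (`cycLevel p k ∅ = p^k`); `changeLevel_of_eq_apply_intCast/_natCast` (`χ'(a) = χ(a)` on integer / natural residues);
`changeLevel_of_eq_apply_cast` (`χ'(b) = χ(cast b)`); `isPrimitive_changeLevel_of_eq`, `even_changeLevel_of_eq`, `orderOf_changeLevel_of_eq`,
`changeLevel_of_eq_inv` (commutes with `⁻¹`), `changeLevel_of_eq_injective/_surjective` (every character mod `m₂` is a `χ'`);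
`ratTwistedSymbolSum_changeLevel_of_eq`; `gaussSum_changeLevel_zmodChar_of_eq` (same root of unity `ζ`, `ζ^{m₁} = ζ^{m₂} = 1`);
`sum_units_inv_mul_changeLevel_of_eq` (`Σ_{b∈(ℤ/m₂)ˣ} χ'⁻¹(b)·G(b) = Σ_{b∈(ℤ/m₁)ˣ} χ⁻¹(b)·G(cast b)` for any `G : ZMod m₂ → R`, e.g.
`G b = τ_b • E`).

References: [Kato2004Asterisque] §13.1 (levels `m = p^k ∏ ℓ`), (5.7.1); [Washington1997] Ch. 3 (induced characters).
-/

set_option autoImplicit false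
-- the Theorems namespace of this sub repeats the summit name by design (D-0017 nested layout)
set_option linter.dupNamespace false

noncomputable section

open scoped BigOperators NumberField

open Literature.NumberTheory.EllipticCurves Literature.NumberTheory.EllipticCurves.Kato2004.EulerSystemValues

namespace Summit.BirchSwinnertonDyer.BirchSwinnertonDyer.Theorems.SignedKatoOffTwo.KatoValue

/-! ## §0 The level at the empty tame part -/

/-- `cycLevel p k ∅ = p^k` (no tame primes). [cite: Kato2004Asterisque, §13.1 (p. 224)] -/
theorem cycLevel_empty_eq (p k : ℕ) : cycLevel p k (∅ : Finset (IsDedekindDomain.HeightOneSpectrum (𝓞 ℚ))) = p ^ k := by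
  rw [cycLevel, Finset.prod_empty, mul_one]

/-! ## §1 Characters along `m₁ = m₂` -/

section Characters

variable {R : Type*} [CommRing R] {m₁ m₂ : ℕ} [NeZero m₂]

/-- `χ'(a) = χ(a)` on integer residues, `χ' = changeLevel (dvd_of_eq h) χ`. [folklore] -/
theorem changeLevel_of_eq_apply_intCast (h : m₁ = m₂) (χ : DirichletCharacter R m₁) (a : ℤ) :
    DirichletCharacter.changeLevel (dvd_of_eq h) χ (a : ZMod m₂) = χ (a : ZMod m₁) := by
  subst h; rw [DirichletCharacter.changeLevel_self]

/-- `χ'(a) = χ(a)` on natural residues. [folklore] -/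
theorem changeLevel_of_eq_apply_natCast (h : m₁ = m₂) (χ : DirichletCharacter R m₁) (a : ℕ) :
    DirichletCharacter.changeLevel (dvd_of_eq h) χ (a : ZMod m₂) = χ (a : ZMod m₁) := by
  subst h; rw [DirichletCharacter.changeLevel_self]

/-- `χ'(b) = χ(cast b)` for every residue `b mod m₂`. [folklore] -/
theorem changeLevel_of_eq_apply_cast (h : m₁ = m₂) (χ : DirichletCharacter R m₁) (b : ZMod m₂) :
    DirichletCharacter.changeLevel (dvd_of_eq h) χ b = χ (ZMod.cast b : ZMod m₁) := by
  subst h; rw [DirichletCharacter.changeLevel_self, ZMod.cast_id]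

/-- `changeLevel` along an equality commutes with inversion. [folklore] -/
theorem changeLevel_of_eq_inv (h : m₁ = m₂) (χ : DirichletCharacter R m₁) :
    DirichletCharacter.changeLevel (dvd_of_eq h) χ⁻¹ = (DirichletCharacter.changeLevel (dvd_of_eq h) χ)⁻¹ := by
  subst h; rw [DirichletCharacter.changeLevel_self, DirichletCharacter.changeLevel_self]

/-- Primitivity is preserved along an equality of moduli. [folklore] -/
theorem isPrimitive_changeLevel_of_eq (h : m₁ = m₂) (χ : DirichletCharacter R m₁) :
    (DirichletCharacter.changeLevel (dvd_of_eq h) χ).IsPrimitive ↔ χ.IsPrimitive := by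
  subst h; rw [DirichletCharacter.changeLevel_self]

/-- Parity is preserved along an equality of moduli. [folklore] -/
theorem even_changeLevel_of_eq (h : m₁ = m₂) (χ : DirichletCharacter R m₁) :
    (DirichletCharacter.changeLevel (dvd_of_eq h) χ).Even ↔ χ.Even := by
  subst h; rw [DirichletCharacter.changeLevel_self]

/-- The order is preserved along an equality of moduli. [folklore] -/
theorem orderOf_changeLevel_of_eq (h : m₁ = m₂) (χ : DirichletCharacter R m₁) :
    orderOf (DirichletCharacter.changeLevel (dvd_of_eq h) χ) = orderOf χ := by
  subst h; rw [DirichletCharacter.changeLevel_self]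

/-- Every character modulo `m₂` comes from one modulo `m₁` along `m₁ = m₂`. [folklore] -/
theorem changeLevel_of_eq_surjective (h : m₁ = m₂) (χ₂ : DirichletCharacter R m₂) :
    ∃ χ : DirichletCharacter R m₁, DirichletCharacter.changeLevel (dvd_of_eq h) χ = χ₂ := by
  subst h; exact ⟨χ₂, by rw [DirichletCharacter.changeLevel_self]⟩

/-- `changeLevel` along an equality is injective. [folklore] -/
theorem changeLevel_of_eq_injective (h : m₁ = m₂) {χ ψ : DirichletCharacter R m₁}
    (hχψ : DirichletCharacter.changeLevel (dvd_of_eq h) χ = DirichletCharacter.changeLevel (dvd_of_eq h) ψ) : χ = ψ := by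
  subst h; rwa [DirichletCharacter.changeLevel_self, DirichletCharacter.changeLevel_self] at hχψ

/-- Composition with a ring homomorphism commutes with `changeLevel` along an equality. [folklore] -/
theorem ringHomComp_changeLevel_of_eq {R' : Type*} [CommRing R'] (h : m₁ = m₂) (χ : DirichletCharacter R m₁) (g : R →+* R') :
    (DirichletCharacter.changeLevel (dvd_of_eq h) χ).ringHomComp g =
      DirichletCharacter.changeLevel (dvd_of_eq h) (χ.ringHomComp g) := by
  subst h; rw [DirichletCharacter.changeLevel_self, DirichletCharacter.changeLevel_self]

end Characters

/-! ## §2 Sums along `m₁ = m₂` -/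

section Sums

variable {m₁ m₂ : ℕ} [NeZero m₁] [NeZero m₂]

/-- **Rational twisted symbol sums are unchanged** along an equality of moduli. [folklore] -/
theorem ratTwistedSymbolSum_changeLevel_of_eq {R : Type*} [Field R] {N : ℕ}
    (f : CuspForm (CongruenceSubgroup.Gamma0 N) 2) (h : m₁ = m₂) (χ : DirichletCharacter R m₁) :
    ratTwistedSymbolSum f (DirichletCharacter.changeLevel (dvd_of_eq h) χ) = ratTwistedSymbolSum f χ := by
  subst h; rw [DirichletCharacter.changeLevel_self]

/-- **Gauss sums against the same root of unity are unchanged** along an equality of moduli. [folklore] -/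
theorem gaussSum_changeLevel_zmodChar_of_eq {R : Type*} [CommRing R] (h : m₁ = m₂) (χ : DirichletCharacter R m₁)
    {ζ : R} (hζ₁ : ζ ^ m₁ = 1) (hζ₂ : ζ ^ m₂ = 1) :
    gaussSum (DirichletCharacter.changeLevel (dvd_of_eq h) χ) (AddChar.zmodChar m₂ hζ₂) = gaussSum χ (AddChar.zmodChar m₁ hζ₁) := by
  subst h; rw [DirichletCharacter.changeLevel_self]

/-- **Unit sums `Σ_b χ⁻¹(b)·G(b)` are unchanged** along an equality of moduli (`G` any function of the residue, e.g. `b ↦ τ_b • E`):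
`Σ_{b ∈ (ℤ/m₂)ˣ} χ'⁻¹(b)·G(b) = Σ_{b ∈ (ℤ/m₁)ˣ} χ⁻¹(b)·G(cast b)`. [folklore] -/
theorem sum_units_inv_mul_changeLevel_of_eq {R : Type*} [CommRing R] (h : m₁ = m₂) (χ : DirichletCharacter R m₁)
    (G : ZMod m₂ → R) :
    ∑ b : (ZMod m₂)ˣ, (DirichletCharacter.changeLevel (dvd_of_eq h) χ)⁻¹ (b : ZMod m₂) * G (b : ZMod m₂) =
      ∑ b : (ZMod m₁)ˣ, χ⁻¹ (b : ZMod m₁) * G (ZMod.cast (b : ZMod m₁) : ZMod m₂) := by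
  subst h
  simp only [DirichletCharacter.changeLevel_self, ZMod.cast_id]

/-- **Plain unit sums `Σ_b χ(b)·G(b)`** along an equality of moduli. [folklore] -/
theorem sum_units_mul_changeLevel_of_eq {R : Type*} [CommRing R] (h : m₁ = m₂) (χ : DirichletCharacter R m₁)
    (G : ZMod m₂ → R) :
    ∑ b : (ZMod m₂)ˣ, DirichletCharacter.changeLevel (dvd_of_eq h) χ (b : ZMod m₂) * G (b : ZMod m₂) =
      ∑ b : (ZMod m₁)ˣ, χ (b : ZMod m₁) * G (ZMod.cast (b : ZMod m₁) : ZMod m₂) := by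
  subst h
  simp only [DirichletCharacter.changeLevel_self, ZMod.cast_id]

omit [NeZero m₁] in
/-- A family `τ : ZMod m₂ → Γ` read at modulus `m₁` (`τ ∘ cast`) has the same values on matching residues; with `h : m₁ = m₂`,
`(cast b : ZMod m₂).val = b.val`. [folklore] -/
theorem val_cast_of_eq (h : m₁ = m₂) (b : ZMod m₁) : (ZMod.cast b : ZMod m₂).val = b.val := by
  subst h; rw [ZMod.cast_id]

end Sums

end Summit.BirchSwinnertonDyer.BirchSwinnertonDyer.Theorems.SignedKatoOffTwo.KatoValue

end
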